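import Mathlib
import Summits.NavierStokesRegularity.NavierStokesRegularity.Theses.TypeIQuarterGate
import Summits.NavierStokesRegularity.NavierStokesRegularity.Theorems.GaldiLiouvilleGateRecordZoomAncientOfKernel
import Literature.Analysis.FluidPDE.TaoEnstrophyLocalisationProofs
import HarnessLib

/-!
# `TypeIQuarterGate.QuarterZoom` — the quarter law feeds the Type-I-enstrophy branch of the
record zoom (item stmt-NavierStokesRegularity-23727)

**Statement (route `TypeIQuarterGate`, support).** `NoTypeII → QuarterLawTypeI →` for every
classical Leray–Hopf solution from a rapidly decaying datum with no smooth extension past `T`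
there is a NONTRIVIAL bounded ancient mild solution (`ν = 1`), smooth on `(−∞,0) × ℝ³`, with
slice enstrophy `≤ 1` and `L⁶` slices (the conclusion of `GaldiLiouvilleGate.RecordZoomAncient`).

PROOF. Under `NoTypeII` the blow-up is velocity-Type-I; `QuarterLawTypeI` then gives the quarter
law `∫|curl u(t)|² ≤ K/√(T−t)` on `[0, T)`. By the `L²` `div`–`curl` estimate
(`lintegral_frobeniusNormSq_fderiv_le_lintegral_sq_norm_curl`) the Frobenius enstrophy
`E(s) = ∫|∇u(s)|²_F` obeys `E(s) ≤ K'/√(T−t)` for `s ≤ t < T` (`K' = max K 1`), i.e. the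
TYPE-I-ENSTROPHY hypothesis (iii) of the landed branch
`RecordZoomAncient.Birth.stub_typeIBranch` of route `GaldiLiouvilleGate` with
`C = K'/(ν√ν)` and `t = t'`. The remaining inputs of that branch are tree theorems: the Tao
representation (`stub_taoRep`), the persistence of the enstrophy (`stub_enstrophyPersistence`)
and Leray's `L^∞` rate (`leray_blowup_rate_top_holds`, turned pointwise by
`exists_half_le_norm_of_ofReal_le_eLpNorm_top`); the branch returns velocity-concentrated
enstrophy-normalised zooms, and the common tail `recordZoomAncient_of_concentratedZooms`
(universal bound after one critical time unit, KNSS compactness, non-triviality at `(s₀, 0)`)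
produces the ancient solution. This is the first (`hI`) branch of
`recordZoomAncient_of_noFaintBlowupKernel`, whose kernel hypothesis is not needed here.

HONEST FRAMING: a conditional statement about HYPOTHETICAL blow-ups (both hypotheses are open
cruxes); nothing here bears on Navier–Stokes regularity.
-/

noncomputable section

set_option linter.dupNamespace false

namespace Summit.NavierStokesRegularity.NavierStokesRegularity.Theorems

open Set MeasureTheory Filter Topology Function
open scoped ENNReal NNReal
open Literature.Analysis.FluidPDE
open RecordZoomAncient.Birth

/-- **Item stmt-NavierStokesRegularity-23727** (`TypeIQuarterGate.QuarterZoom`): under `NoTypeII` and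
`QuarterLawTypeI`, a non-extendable Leray–Hopf classical solution from a rapidly decaying datum has a
nontrivial bounded ancient mild zoom limit with slice enstrophy `≤ 1` and `L⁶` slices — the
Type-I-enstrophy branch `stub_typeIBranch` of the `GaldiLiouvilleGate` record-zoom line plus its
common tail. [cite: KochNadirashviliSereginSverak2009, Thm 1.2 (compactness of zooms); Leray1934, §20] -/
theorem typeIQuarterGate_quarterZoom_proof :
    Summit.NavierStokesRegularity.NavierStokesRegularity.Theses.TypeIQuarterGate.QuarterZoom := by
  unfold Summit.NavierStokesRegularity.NavierStokesRegularity.Theses.TypeIQuarterGate.QuarterZoom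
    Summit.NavierStokesRegularity.NavierStokesRegularity.Theses.TypeIQuarterGate.NoTypeII
    Summit.NavierStokesRegularity.NavierStokesRegularity.Theses.TypeIQuarterGate.QuarterLawTypeI
  intro hII hQ ν T hν hT u p hcl hLH hdec hnext
  have hmax : IsMaximalSmoothSolution ν 0 u p T := ⟨hcl, hnext⟩
  have hI : IsTypeIBlowup u T := hII ν T hν hT u p hmax hLH hdec
  obtain ⟨K, hK⟩ := hQ ν T hν hT u p hmax hLH hdec hI
  -- (0) the representation: `u` is Tao-class on every `[0, T']`, `T' < T`
  have hrep : ∀ T' ∈ Set.Ioo 0 T, ∃ P : ℝ → EuclideanSpace ℝ (Fin 3) → ℝ,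
      IsTaoSolutionOn T' ν (u 0) u P :=
    stub_taoRep ν T hν hT u p hcl hLH hdec
  -- (1) persistence constants
  obtain ⟨cP, KP, hcP, hKP, hpers⟩ := stub_enstrophyPersistence
  have hpers' := hpers ν T hν hT u p hcl hrep
  -- Leray's `L^∞` blow-up rate, strip-boundedness from the representation
  obtain ⟨cL, hcL, hLer⟩ := leray_blowup_rate_top_holds
  have hstrip : ∀ T' ∈ Set.Ioo 0 T,
      eLpNorm (uncurry u) ∞ (volume.restrict (Set.Icc 0 T' ×ˢ univ)) < ∞ := by
    intro T' hT'
    obtain ⟨P, hP⟩ := hrep T' hT'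
    obtain ⟨B, -, hB⟩ := hP.exists_bound_velocity
    rw [eLpNorm_exponent_top]
    refine eLpNormEssSup_lt_top_of_ae_bound (C := B) ?_
    filter_upwards [ae_restrict_mem (measurableSet_Icc.prod MeasurableSet.univ)] with w hw
    obtain ⟨t, x⟩ := w
    exact hB t hw.1 x
  have hrate : ∀ t ∈ Set.Ico 0 T, ∃ x, cL / 2 * Real.sqrt ν / Real.sqrt (T - t) ≤ ‖u t x‖ := by
    intro t ht
    have h := hLer ν T hν hT u p ⟨hcl, hnext⟩ hLH hstrip t ht
    have ha : 0 < cL * Real.sqrt ν / Real.sqrt (T - t) := by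
      have h1 : 0 < Real.sqrt ν := Real.sqrt_pos.2 hν
      have h2 : 0 < Real.sqrt (T - t) := Real.sqrt_pos.2 (sub_pos.2 ht.2)
      positivity
    obtain ⟨x, hx⟩ := exists_half_le_norm_of_ofReal_le_eLpNorm_top ha h
    refine ⟨x, ?_⟩
    have heq : cL / 2 * Real.sqrt ν / Real.sqrt (T - t) =
        cL * Real.sqrt ν / Real.sqrt (T - t) / 2 := by ring
    rw [heq]
    exact hx
  -- (2) the quarter law in Frobenius form: Type-I enstrophy at EVERY time
  set K' : ℝ := max K 1 with hK'
  have hK'0 : 0 < K' := lt_of_lt_of_le one_pos (le_max_right _ _)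
  have hsν : 0 < ν * Real.sqrt ν := mul_pos hν (Real.sqrt_pos.2 hν)
  set C : ℝ := K' / (ν * Real.sqrt ν) with hC
  have hC0 : 0 < C := div_pos hK'0 hsν
  have hCid : ∀ t, C * (ν * Real.sqrt ν) / Real.sqrt (T - t) = K' / Real.sqrt (T - t) := by
    intro t
    rw [hC, div_mul_cancel₀ _ hsν.ne']
  have hfrob : ∀ s ∈ Set.Ico 0 T,
      (∫⁻ x, ENNReal.ofReal (frobeniusNormSq (fderiv ℝ (u s) x))) ≤
        ENNReal.ofReal (K / Real.sqrt (T - s)) := by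
    intro s hs
    have hs2 : ContDiff ℝ 2 (u s) := (hcl.contDiff_velocity hs).of_le (by norm_cast)
    have hL2 : ∫⁻ x, ‖u s x‖ₑ ^ 2 < ⊤ := by
      have hm : MemLp (u s) 2 volume := hLH.memLp s ⟨hs.1, hs.2.le⟩
      have h := lintegral_rpow_enorm_lt_top_of_eLpNorm_lt_top two_ne_zero ENNReal.ofNat_ne_top
        hm.eLpNorm_lt_top
      simpa [ENNReal.toReal_ofNat] using h
    exact (lintegral_frobeniusNormSq_fderiv_le_lintegral_sq_norm_curl hs2 (hcl.divFree s hs)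
      hL2).trans (hK s hs)
  have hIII : ∀ t' ∈ Set.Ico 0 T, ∃ t ∈ Set.Ico t' T, ∀ s ∈ Set.Icc 0 t,
      (∫⁻ x, ENNReal.ofReal (frobeniusNormSq (fderiv ℝ (u s) x))) ≤
        ENNReal.ofReal (C * (ν * Real.sqrt ν) / Real.sqrt (T - t)) := by
    intro t' ht'
    refine ⟨t', ⟨le_rfl, ht'.2⟩, fun s hs => ?_⟩
    have hsT : s ∈ Set.Ico 0 T := ⟨hs.1, hs.2.trans_lt ht'.2⟩
    refine (hfrob s hsT).trans (ENNReal.ofReal_le_ofReal ?_)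
    rw [hCid]
    have h1 : 0 < Real.sqrt (T - t') := Real.sqrt_pos.2 (sub_pos.2 ht'.2)
    have h2 : Real.sqrt (T - t') ≤ Real.sqrt (T - s) := Real.sqrt_le_sqrt (by linarith [hs.2])
    calc K / Real.sqrt (T - s) ≤ K' / Real.sqrt (T - s) :=
          div_le_div_of_nonneg_right (le_max_left _ _) (h1.le.trans h2)
      _ ≤ K' / Real.sqrt (T - t') := div_le_div_of_nonneg_left hK'0.le h1 h2
  -- (3) the Type-I-enstrophy branch and the common tail
  obtain ⟨tc, xc, L, s₀, θ, hs₀, hθ, htc, hL, hdom, hpast, hconc⟩ :=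
    stub_typeIBranch ν T hν hT u p hcl (cL / 2) (by positivity) hrate cP KP hcP hKP hpers' C hC0 hIII
  exact recordZoomAncient_of_concentratedZooms ν T hν hT u p hcl hLH hdec tc xc L s₀ θ hs₀ hθ htc hL
    hdom hpast hconc

end Summit.NavierStokesRegularity.NavierStokesRegularity.Theorems

end
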